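import Summits.Ventures.GridStability.Lyapunov.WSCC9LossySplitLinesLPDualData
import Summits.Ventures.GridStability.Lyapunov.WSCC9LossySplitLinesLPCert
import Literature.MathematicalPhysics.PowerSystems.LuriePostnikovSlabPositivityDual
import Summits.Ventures.GridStability.Bench.WSCC9LossySplitLinesRoa
import HarnessLib

/-!
# «SPLITU-LPCEIL» — the Lur'e–Postnikov POSITIVITY class on the UNORDERED-LINES split presentation of
# the lossy 9-bus is EMPTY from `2·arctan(3/40)` on (file 2 of 2: the LP dual witness over `ℝ` and the theorem)

**OBSTRUCTION row for the WIDER class beside «SPLITU-8°» (#122) and «SPLITU-CEILING» (#127).**  For the unordered-lines split Lur'e object of the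
post-fault WSCC 3-machine classical model WITH transfer conductances, `S = WSCC9.splitLurieLinesSystem`
(MODEL M′ = `WSCC9.postB_SPdamp.toModel`: post-fault-B Kron reduction, h12 couplings, non-uniform damping
`D_i/M_i = 1/10, 1/5, 3/10`; Pai's split presentation (3.43) with one sine and one cosine channel per
ordered pair, `Models/WSCC9SplitLurieLines.lean`), and the window `γ₀ = 2·arctan(3/40)` (≈ 8.578°):

* `D : LPSlabDualWitness WSCC9.splitLurieLinesSystem a0 b0` — lit-6's LP dual witness (Literature
  `LuriePostnikovSlabPositivityDual.lean`: `Z ⪰ 0`, (D1) `W + Wᵀ ⪰ 0` EXACTLY (rational `B`), (D2), (D3′)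
  `a0_k·q_k ≤ 2 s_k`, (D4)), every field from the kernel decisions of file 1 by cast identities;
* `no_lpSplitCertificate_at` — **no** `Λ : LPSlabCertificate WSCC9.splitLurieLinesSystem` (coercivity
  `P + Cᵀ·diag(λa)·C ⪰ ε·1`, `P` free) satisfies the sector hypothesis `hsec` of lit-6's LP ROA theorem
  (`LPSlabCertificate.well_subset_regionOfAttraction`) for the window `γ₀`;
* `no_lpSplitCertificate` / `lpSplitClass_empty` / `no_lpSplitCertificate_perChannel` — nor for any window
  (function) `≥ γ₀` (on the twelve channels `p ≠ q`) — for the class of record #127's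
  `WSCC9LossySplitLinesDual.no_splitSlabCertificate` (from `2·arctan(71/1000)`) is the stronger statement;
* `lpSplitClass_nonempty_at_split8` — the positivity class is NON-EMPTY at #122's `2·arctan(7/100)` (`cert.toLP`);
* `lpSplitClassCeiling_bracket` — with «SPLITU-LPCERT» (`WSCC9LossySplitLinesLPCert.lpSplitClass_nonempty`: an
  exact positivity certificate at `2·arctan(37/500)` ≈ 8.464°) the positivity class optimum lies in
  `(2·arctan(37/500), 2·arctan(3/40)]` = (8.464°, 8.578°] — against (8.008°, 8.122°] for the class of record;
* `γ₀_dual71_lt_γ₀`, `γ74_lt_γ₀`, `γ₀_le` — the windows in closed form.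

THREE COLUMNS.  CERTIFIED: «no certificate of the WIDER typed split class (`LPSlabCertificate WSCC9.splitLurieLinesSystem`
+ `hsec`; it contains the class of record by `SlabCertificate.toLP`) certifies a slab half-width
`≥ 2·arctan(3/40)` (≈ 8.578°)».  VALIDATED (floats + exact rational objects, lit-6 kit j289677 and
j289752): for the POSITIVITY class the dual margin `μ*` / primal margin `ν*` change sign together between
`u = 37/500` (`-3.6e-07` / `1.5e-05`) and `3/40` (`5.7e-07` / `-2.5e-05`), and EXACT rational
positivity certificates (indefinite `P`, `P + Cᵀ·diag(λa)·C ≻ ε·1`) exist at `9/125`, `73/1000`, `37/500`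
(≈ 8.236°, 8.350°, 8.464°; typed separately) — unlike on the directed-polar form («#74-LP»: < 0.23° of
window), the positivity lever MOVES the split window ceiling from (8.008°, 8.122°] (#122/#127) to
(8.464°, 8.578°].  MODELLED: as #122 (object identity = `WSCC9LossySplitLines.A_eq/C_eq/B_eq`, by name).
The sentence is about CERTIFICATE CLASSES, not about the region of attraction of `M′` or of any grid.
[cite: BoydVandenberghe2004, §5.9.4 (5.97)–(5.98), Example 5.14; Khalil2002, §7.1 Example 7.5, §7.1.2 Theorem 7.3; Pai1981, §3.6.3 (3.43)–(3.45), §4.6 p. 117]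
-/

noncomputable section

open Real Matrix
open Literature.Computation.Certificates
open Literature.MathematicalPhysics.PowerSystems
open Literature.MathematicalPhysics.PowerSystems.LyapunovFunctionFamily
open Summit.Ventures.GridStability.Models
open Summit.Ventures.GridStability.Lyapunov.WSCC9LossySplitSlab (e1 eκ e2 AQ CQ)
open Summit.Ventures.GridStability.Lyapunov.WSCC9LossySplitLines (BLQ A_eq C_eq B_eq)

namespace Summit.Ventures.GridStability.Lyapunov.WSCC9LossySplitLinesLPDual

/-! ### Cast plumbing (the parent files' copies are private) -/

/-- `(M + N) ↦ ℝ` (cast plumbing). -/ private theorem map_add' {m n : Type*} (M N : Matrix m n ℚ) :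
    (M + N).map (Rat.cast : ℚ → ℝ) = M.map (Rat.cast : ℚ → ℝ) + N.map (Rat.cast : ℚ → ℝ) := by
  ext i k; simp
/-- `(M − N) ↦ ℝ` (cast plumbing). -/ private theorem map_sub' {m n : Type*} (M N : Matrix m n ℚ) :
    (M - N).map (Rat.cast : ℚ → ℝ) = M.map (Rat.cast : ℚ → ℝ) - N.map (Rat.cast : ℚ → ℝ) := by
  ext i k; simp
/-- `(q • M) ↦ ℝ` (cast plumbing). -/ private theorem map_smul' {m n : Type*} (q : ℚ) (M : Matrix m n ℚ) :
    (q • M).map (Rat.cast : ℚ → ℝ) = ((q : ℚ) : ℝ) • M.map (Rat.cast : ℚ → ℝ) := by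
  ext i k; simp
/-- `(M N) ↦ ℝ` (cast plumbing). -/ private theorem map_mul' {l m n : Type*} [Fintype m] (M : Matrix l m ℚ) (N : Matrix m n ℚ) :
    (M * N).map (Rat.cast : ℚ → ℝ) = M.map (Rat.cast : ℚ → ℝ) * N.map (Rat.cast : ℚ → ℝ) := by
  ext i k; simp [Matrix.mul_apply]
/-- `Mᵀ ↦ ℝ` (cast plumbing). -/ private theorem map_transpose' {m n : Type*} (M : Matrix m n ℚ) :
    Mᵀ.map (Rat.cast : ℚ → ℝ) = (M.map (Rat.cast : ℚ → ℝ))ᵀ := by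
  ext i k; simp

/-! ### The witness data over `ℝ` -/

/-- `Z₁₁ ↦ ℝ`. -/
def Z₁₁ : Matrix (Fin 3 ⊕ Fin 2) (Fin 3 ⊕ Fin 2) ℝ := Z11Q.map (Rat.cast : ℚ → ℝ)
/-- `Z₂₁ ↦ ℝ`. -/
def Z₂₁ : Matrix ((Fin 3 × Fin 3) ⊕ (Fin 3 × Fin 3)) (Fin 3 ⊕ Fin 2) ℝ := Z21Q.map (Rat.cast : ℚ → ℝ)
/-- `Z₂₂ ↦ ℝ`. -/
def Z₂₂ : Matrix ((Fin 3 × Fin 3) ⊕ (Fin 3 × Fin 3)) ((Fin 3 × Fin 3) ⊕ (Fin 3 × Fin 3)) ℝ := Z22Q.map (Rat.cast : ℚ → ℝ)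
/-- The witness's lower slopes over `ℝ`. -/
def a0 (k : (Fin 3 × Fin 3) ⊕ (Fin 3 × Fin 3)) : ℝ := (a0K k : ℝ)
/-- The witness's upper slopes over `ℝ`. -/
def b0 (k : (Fin 3 × Fin 3) ⊕ (Fin 3 × Fin 3)) : ℝ := (b0K k : ℝ)
/-- The window `γ₀ = 2·arctan(3/40)` (≈ 8.578°). -/
def γ₀ : ℝ := 2 * Real.arctan ((u0Q : ℚ) : ℝ)

/-- `γ₀` is the literal window `2·arctan(3/40)` of the row's name. -/
theorem γ₀_eq : γ₀ = 2 * Real.arctan (3 / 40 : ℝ) := by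
  unfold γ₀; norm_num [u0Q]

/-- `cos γ₀ = cg0Q` (cast form, feeds `hwin`; private: text-twin of ★ #74's). -/
private theorem cos_γ₀_cast : Real.cos γ₀ = ((cg0Q : ℚ) : ℝ) := by
  unfold γ₀ cg0Q
  rw [Lyapunov.StructurePreserving.cos_two_mul_arctan]
  push_cast
  ring

/-- `sin γ₀ = sg0Q` (cast form, feeds `hwin`; private: text-twin of ★ #74's). -/
private theorem sin_γ₀_cast : Real.sin γ₀ = ((sg0Q : ℚ) : ℝ) := by
  unfold γ₀ sg0Q
  rw [Lyapunov.StructurePreserving.sin_two_mul_arctan]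
  push_cast
  ring

/-- **`cos(2·arctan(3/40)) = 1591/1609`**, **`sin = 240/1609`** (closed forms). -/
theorem cos_sin_γ₀ : Real.cos (2 * Real.arctan (3 / 40 : ℝ)) = 1591 / 1609 ∧ Real.sin (2 * Real.arctan (3 / 40 : ℝ)) = 240 / 1609 := by
  rw [← γ₀_eq, cos_γ₀_cast, sin_γ₀_cast]; constructor <;> norm_num [cg0Q, sg0Q, u0Q]

/-- `0 ≤ γ₀ < π/2` (private: text-twin of #127's). -/
private theorem γ₀_range : 0 ≤ γ₀ ∧ γ₀ < π / 2 := by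
  have hu : (0 : ℝ) ≤ ((u0Q : ℚ) : ℝ) := by exact_mod_cast u0Q_pos_lt.1.le
  have hu1 : ((u0Q : ℚ) : ℝ) < 1 := by exact_mod_cast u0Q_pos_lt.2
  exact ⟨Lyapunov.StructurePreserving.two_mul_arctan_nonneg hu,
    Lyapunov.StructurePreserving.two_mul_arctan_lt_pi_div_two hu1⟩

/-- `γ₀ ≤ 3 / 20` rad (`arctan u ≤ u`). -/
theorem γ₀_le : γ₀ ≤ 3 / 20 := by
  unfold γ₀
  have h : Real.arctan ((u0Q : ℚ) : ℝ) ≤ ((u0Q : ℚ) : ℝ) :=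
    Lyapunov.StructurePreserving.arctan_le_self (by exact_mod_cast u0Q_pos_lt.1.le)
  have : ((u0Q : ℚ) : ℝ) = 3 / 40 := by norm_num [u0Q]
  linarith

/-! ### `Z ⪰ 0` and (D1) over `ℝ` -/

/-- The receptacle's block matrix is `ZQ ↦ ℝ` (plumbing). -/
private theorem fromBlocks_eq : Matrix.fromBlocks Z₁₁ Z₂₁ᵀ Z₂₁ Z₂₂ = ZQ.map (Rat.cast : ℚ → ℝ) := by
  rw [ZQ, Matrix.fromBlocks_map, Z₁₁, Z₂₁, Z₂₂, map_transpose']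

/-- **`Z ⪰ 0`** (feeds `D`). -/
private theorem psd : (Matrix.fromBlocks Z₁₁ Z₂₁ᵀ Z₂₁ Z₂₂).PosSemidef := by
  rw [fromBlocks_eq]
  have h := (ZQ_ldl.posSemidef (R := ℝ)).submatrix e2
  have e : ((ZQ.submatrix ⇑e2.symm ⇑e2.symm).map (Rat.cast : ℚ → ℝ)).submatrix e2 e2
      = ZQ.map (Rat.cast : ℚ → ℝ) := by
    ext i j; simp
  rwa [e] at h

/-- **The adjoint image is rational**: `W + Wᵀ = HQ ↦ ℝ` (from `A_eq`, `B_eq`: no weight box on this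
presentation; plumbing). -/
private theorem adj_eq : dualAdjP WSCC9.splitLurieLinesSystem Z₁₁ Z₂₁ + (dualAdjP WSCC9.splitLurieLinesSystem Z₁₁ Z₂₁)ᵀ
    = HQ.map (Rat.cast : ℚ → ℝ) := by
  have hX : dualAdjP WSCC9.splitLurieLinesSystem Z₁₁ Z₂₁ = XQ.map (Rat.cast : ℚ → ℝ) := by
    rw [dualAdjP, A_eq, B_eq, Z₁₁, Z₂₁, XQ, map_sub', map_add', map_mul', map_mul', map_transpose',
      map_smul', map_mul', Rat.cast_ofNat]
  rw [hX, HQ, map_add', map_transpose']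

/-- **(D1)** `W + Wᵀ ⪰ 0` (feeds `D`). -/
private theorem adjP_psd :
    (dualAdjP WSCC9.splitLurieLinesSystem Z₁₁ Z₂₁ + (dualAdjP WSCC9.splitLurieLinesSystem Z₁₁ Z₂₁)ᵀ).PosSemidef := by
  rw [adj_eq]
  have h := (HQ_ldl.posSemidef (R := ℝ)).submatrix e1
  have e : ((HQ.submatrix ⇑e1.symm ⇑e1.symm).map (Rat.cast : ℚ → ℝ)).submatrix e1 e1
      = HQ.map (Rat.cast : ℚ → ℝ) := by
    ext i j; simp
  rwa [e] at h

/-! ### (D2), (D3), (D4) and the null channels over `ℝ` -/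

/-- The five dual functionals are the casts of `UQ`, `VQ`, `WQ`, `SQ`, `QQ` (the positivity functional
`q_k = (C·W·Cᵀ)_kk` loses its `B`-part because `C·B = 0`). -/
theorem functionals_eq (k : (Fin 3 × Fin 3) ⊕ (Fin 3 × Fin 3)) :
    (WSCC9.splitLurieLinesSystem.C * Z₁₁ * WSCC9.splitLurieLinesSystem.Cᵀ) k k = ((UQ k : ℚ) : ℝ) ∧
    (Z₂₁ * WSCC9.splitLurieLinesSystem.Cᵀ) k k = ((VQ k : ℚ) : ℝ) ∧
    Z₂₂ k k = ((WQ k : ℚ) : ℝ) ∧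
    dualPopovCoeff WSCC9.splitLurieLinesSystem Z₂₁ Z₂₂ k = ((SQ k : ℚ) : ℝ) ∧
    dualLowerCoeff WSCC9.splitLurieLinesSystem Z₁₁ Z₂₁ k = ((QQ k : ℚ) : ℝ) := by
  have hCB := WSCC9LossySplitLinesDual.C_mul_B
  refine ⟨?_, ?_, ?_, ?_, ?_⟩
  · rw [C_eq, Z₁₁, ← map_transpose', ← map_mul', ← map_mul', Matrix.map_apply, UQ]
  · rw [C_eq, Z₂₁, ← map_transpose', ← map_mul', Matrix.map_apply, VQ]
  · rw [Z₂₂, Matrix.map_apply, WQ]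
  · rw [dualPopovCoeff, Matrix.mul_assoc, ← Matrix.mul_assoc WSCC9.splitLurieLinesSystem.C, hCB,
      Matrix.zero_mul, Matrix.zero_apply, sub_zero, C_eq, A_eq, Z₂₁, ← map_mul', ← map_transpose',
      ← map_mul', Matrix.map_apply, SQ]
  · have hsplit : WSCC9.splitLurieLinesSystem.C * dualAdjP WSCC9.splitLurieLinesSystem Z₁₁ Z₂₁ * WSCC9.splitLurieLinesSystem.Cᵀ
        = WSCC9.splitLurieLinesSystem.C * (Z₁₁ * WSCC9.splitLurieLinesSystem.Aᵀ + WSCC9.splitLurieLinesSystem.A * Z₁₁) * WSCC9.splitLurieLinesSystem.Cᵀ := by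
      rw [dualAdjP, Matrix.mul_sub, Matrix.sub_mul, Matrix.mul_smul, Matrix.smul_mul,
        ← Matrix.mul_assoc WSCC9.splitLurieLinesSystem.C WSCC9.splitLurieLinesSystem.B, hCB, Matrix.zero_mul, Matrix.zero_mul, smul_zero, sub_zero]
    rw [dualLowerCoeff, hsplit, C_eq, A_eq, Z₁₁, ← map_transpose', ← map_mul', ← map_mul', ← map_add',
      ← map_mul', ← map_transpose', ← map_mul', Matrix.map_apply, QQ]

/-- **(D2)** at the witness slopes (feeds `D`). -/
private theorem sectorCoeff_nonneg (k : (Fin 3 × Fin 3) ⊕ (Fin 3 × Fin 3)) :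
    0 ≤ dualSectorCoeff WSCC9.splitLurieLinesSystem Z₁₁ Z₂₁ Z₂₂ a0 b0 k := by
  obtain ⟨hU, hV, hW, -, -⟩ := functionals_eq k
  rw [dualSectorCoeff, hU, hV, hW, a0, b0]
  exact_mod_cast (lpDual_tests k).1

/-- **(D3′)** on every channel: `a0_k · q_k ≤ 2 s_k` (feeds `D`). -/
private theorem lowerPopovCoeff_le (k : (Fin 3 × Fin 3) ⊕ (Fin 3 × Fin 3)) :
    a0 k * dualLowerCoeff WSCC9.splitLurieLinesSystem Z₁₁ Z₂₁ k ≤ 2 * dualPopovCoeff WSCC9.splitLurieLinesSystem Z₂₁ Z₂₂ k := by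
  obtain ⟨-, -, -, hS, hQ⟩ := functionals_eq k
  rw [hS, hQ, a0]
  exact_mod_cast (lpDual_tests k).2.1

/-- **(D4a)** `a0 < b0` (feeds `D`). -/
private theorem slope_lt (k : (Fin 3 × Fin 3) ⊕ (Fin 3 × Fin 3)) : a0 k < b0 k := by
  unfold a0 b0; exact_mod_cast (lpDual_tests k).2.2.1

/-- **(D4b)** `tr Z₁₁ > 0` (feeds `D`). -/
private theorem trace_pos : 0 < Matrix.trace Z₁₁ := by
  have h : Matrix.trace Z₁₁ = ((Matrix.trace Z11Q : ℚ) : ℝ) := by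
    simp [Z₁₁, Matrix.trace, Rat.cast_sum]
  rw [h]; exact_mod_cast trace_test

/-- **THE LP DUAL WITNESS** against the Lur'e–Postnikov POSITIVITY certificate class on `S = WSCC9.splitLurieLinesSystem`
at the window-end-point slopes `(a0, b0)` of the window `γ₀ = 2·arctan(3/40)`.
[cite: BoydVandenberghe2004, §5.9.4 (5.97)–(5.98), Example 5.14; Khalil2002, §7.1 Example 7.5] -/
def D : LPSlabDualWitness WSCC9.splitLurieLinesSystem a0 b0 where
  Z₁₁ := Z₁₁
  Z₂₁ := Z₂₁
  Z₂₂ := Z₂₂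
  psd := psd
  adjP_psd := adjP_psd
  sectorCoeff_nonneg := sectorCoeff_nonneg
  lowerPopovCoeff_le := lowerPopovCoeff_le
  slope_lt := slope_lt
  trace_pos := trace_pos

/-- The diagonal channels (both families) are NULL for the LP witness (five vanishing functionals). -/
private theorem isNull_diag (k : (Fin 3 × Fin 3) ⊕ (Fin 3 × Fin 3)) (hk : (pairOf k).1 = (pairOf k).2) : D.IsNull k := by
  obtain ⟨hU, hV, hW, hS, hQ⟩ := functionals_eq k
  obtain ⟨h1, h2, h3, h4, h5⟩ := (lpDual_tests k).2.2.2 hk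
  refine ⟨⟨?_, ?_, ?_, ?_⟩, ?_⟩
  · show (WSCC9.splitLurieLinesSystem.C * Z₁₁ * WSCC9.splitLurieLinesSystem.Cᵀ) k k = 0; rw [hU]; exact_mod_cast h1
  · show (Z₂₁ * WSCC9.splitLurieLinesSystem.Cᵀ) k k = 0; rw [hV]; exact_mod_cast h2
  · show Z₂₂ k k = 0; rw [hW]; exact_mod_cast h3
  · show dualPopovCoeff WSCC9.splitLurieLinesSystem Z₂₁ Z₂₂ k = 0; rw [hS]; exact_mod_cast h4
  · show dualLowerCoeff WSCC9.splitLurieLinesSystem Z₁₁ Z₂₁ k = 0; rw [hQ]; exact_mod_cast h5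

/-! ### The window end points of the twelve channels `p ≠ q` (exact cosines) -/

/-- The two window end points `δ ± γ` and their cosines from `(cos δ, sin δ) = (cδ, sδ)`,
`(cos γ, sin γ) = (c, s)`. -/
private theorem window_points {δ γ cδ sδ c s : ℝ} (hc : Real.cos δ = cδ) (hs : Real.sin δ = sδ)
    (hcg : Real.cos γ = c) (hsg : Real.sin γ = s) (hγ : 0 ≤ γ) :
    (∃ ξ, |ξ - δ| ≤ γ ∧ Real.cos ξ = cδ * c - sδ * s) ∧ (∃ ξ, |ξ - δ| ≤ γ ∧ Real.cos ξ = cδ * c + sδ * s) :=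
  ⟨⟨δ + γ, by simp [abs_of_nonneg hγ], by rw [Real.cos_add, hc, hs, hcg, hsg]⟩,
    ⟨δ - γ, by simp [abs_of_nonneg hγ], by rw [Real.cos_sub, hc, hs, hcg, hsg]⟩⟩

/-- **`hwin`**: every channel is NULL or has window points `ξa`, `ξb` in `|ξ − δ*_k| ≤ γ₀` with
`cos ξa ≤ a0_k`, `b0_k ≤ cos ξb` — the end points `δ*_k ± γ₀`, whose exact cosines `window_tests_sin/_cos`
compare with `a0/b0` in the kernel (same shape as #127's `hwin`, for the LP witness). -/
private theorem hwin : ∀ k, D.IsNull k ∨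
    ((∃ ξ, |ξ - WSCC9.splitLurieLinesSystem.δs k| ≤ γ₀ ∧ Real.cos ξ ≤ a0 k) ∧
      ∃ ξ, |ξ - WSCC9.splitLurieLinesSystem.δs k| ≤ γ₀ ∧ b0 k ≤ Real.cos ξ) := by
  rintro (⟨p, q⟩ | ⟨p, q⟩)
  · by_cases hpq : p = q
    · exact Or.inl (isNull_diag _ hpq)
    right
    have hδs : WSCC9.splitLurieLinesSystem.δs (Sum.inl (p, q))
        = WSCC9.postB_SPdamp.angleOf p - WSCC9.postB_SPdamp.angleOf q := rfl
    obtain ⟨⟨ξ₁, hξ₁, hc₁⟩, ξ₂, hξ₂, hc₂⟩ := window_points (WSCC9.cos_angleOf_sub p q)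
      (WSCC9.sin_angleOf_sub p q) cos_γ₀_cast sin_γ₀_cast γ₀_range.1
    obtain ⟨hlo, hhi⟩ := window_tests_sin p q hpq
    rw [hδs]
    refine ⟨?_, ?_⟩
    · rcases hlo with h | h
      · exact ⟨ξ₁, hξ₁, by rw [hc₁, a0]; exact_mod_cast h⟩
      · exact ⟨ξ₂, hξ₂, by rw [hc₂, a0]; exact_mod_cast h⟩
    · rcases hhi with h | h
      · exact ⟨ξ₁, hξ₁, by rw [hc₁, b0]; exact_mod_cast h⟩
      · exact ⟨ξ₂, hξ₂, by rw [hc₂, b0]; exact_mod_cast h⟩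
  · by_cases hpq : p = q
    · exact Or.inl (isNull_diag _ hpq)
    right
    have hδs : WSCC9.splitLurieLinesSystem.δs (Sum.inr (p, q))
        = WSCC9.postB_SPdamp.angleOf p - WSCC9.postB_SPdamp.angleOf q + π / 2 := rfl
    have hc : Real.cos (WSCC9.postB_SPdamp.angleOf p - WSCC9.postB_SPdamp.angleOf q + π / 2)
        = -((WSCC9.postB_SPdamp.sd p q : ℚ) : ℝ) := by
      rw [Real.cos_add_pi_div_two, WSCC9.sin_angleOf_sub]
    have hs : Real.sin (WSCC9.postB_SPdamp.angleOf p - WSCC9.postB_SPdamp.angleOf q + π / 2)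
        = ((WSCC9.postB_SPdamp.cd p q : ℚ) : ℝ) := by
      rw [Real.sin_add_pi_div_two, WSCC9.cos_angleOf_sub]
    obtain ⟨⟨ξ₁, hξ₁, hc₁⟩, ξ₂, hξ₂, hc₂⟩ := window_points hc hs cos_γ₀_cast sin_γ₀_cast γ₀_range.1
    obtain ⟨hlo, hhi⟩ := window_tests_cos p q hpq
    rw [hδs]
    refine ⟨?_, ?_⟩
    · rcases hlo with h | h
      · exact ⟨ξ₁, hξ₁, by rw [hc₁, a0]; exact_mod_cast h⟩
      · exact ⟨ξ₂, hξ₂, by rw [hc₂, a0]; exact_mod_cast h⟩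
    · rcases hhi with h | h
      · exact ⟨ξ₁, hξ₁, by rw [hc₁, b0]; exact_mod_cast h⟩
      · exact ⟨ξ₂, hξ₂, by rw [hc₂, b0]; exact_mod_cast h⟩

/-! ### THE THEOREM -/

/-- **No Lur'e–Postnikov POSITIVITY certificate on the split presentation at the window `γ₀`.**  No
`Λ : LPSlabCertificate WSCC9.splitLurieLinesSystem` satisfies the sector hypothesis of lit-6's LP ROA theorem on
the window `|ξ − δ*_k| ≤ γ₀ = 2·arctan(3/40)`: the LP dual witness `D` refutes it (weak theorem of
alternatives).  CERTIFIED sentence: the WIDER typed split certificate class is EMPTY at `γ₀`.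
[cite: BoydVandenberghe2004, §5.9.4 (5.97)–(5.98), Example 5.14; Khalil2002, §7.1 Example 7.5] -/
theorem no_lpSplitCertificate_at (Λ : LPSlabCertificate WSCC9.splitLurieLinesSystem)
    (hsec : ∀ k ξ, |ξ - WSCC9.splitLurieLinesSystem.δs k| ≤ γ₀ → Λ.a k ≤ Real.cos ξ ∧ Real.cos ξ ≤ Λ.b k) :
    False :=
  Λ.false_of_lpDualWitness_of_exists_window D (γ := fun _ => γ₀) hsec hwin

/-- **No positivity certificate at any window `γ ≥ γ₀`** (the sector hypothesis for `γ` implies it for `γ₀`). -/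
theorem no_lpSplitCertificate (Λ : LPSlabCertificate WSCC9.splitLurieLinesSystem) {γ : ℝ} (hγ : γ₀ ≤ γ)
    (hsec : ∀ k ξ, |ξ - WSCC9.splitLurieLinesSystem.δs k| ≤ γ → Λ.a k ≤ Real.cos ξ ∧ Real.cos ξ ≤ Λ.b k) :
    False :=
  no_lpSplitCertificate_at Λ fun k ξ hξ => hsec k ξ (hξ.trans hγ)

/-- **The split positivity class is empty from `γ₀` on** (set form). -/
theorem lpSplitClass_empty (γ : ℝ) (hγ : γ₀ ≤ γ) :
    ¬ ∃ Λ : LPSlabCertificate WSCC9.splitLurieLinesSystem,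
      ∀ k ξ, |ξ - WSCC9.splitLurieLinesSystem.δs k| ≤ γ → Λ.a k ≤ Real.cos ξ ∧ Real.cos ξ ≤ Λ.b k :=
  fun ⟨Λ, hsec⟩ => no_lpSplitCertificate Λ hγ hsec

/-- **Per-channel windows**: the refutation needs the window only on the twelve channels `p ≠ q` and only
`γ_k ≥ γ₀` there. -/
theorem no_lpSplitCertificate_perChannel (Λ : LPSlabCertificate WSCC9.splitLurieLinesSystem) (γ : (Fin 3 × Fin 3) ⊕ (Fin 3 × Fin 3) → ℝ)
    (hγ : ∀ k, (pairOf k).1 ≠ (pairOf k).2 → γ₀ ≤ γ k)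
    (hsec : ∀ k ξ, |ξ - WSCC9.splitLurieLinesSystem.δs k| ≤ γ k → Λ.a k ≤ Real.cos ξ ∧ Real.cos ξ ≤ Λ.b k) :
    False := by
  refine Λ.false_of_lpDualWitness_of_exists_window D (γ := γ) hsec fun k => ?_
  by_cases hk : (pairOf k).1 = (pairOf k).2
  · exact Or.inl (isNull_diag k hk)
  · rcases hwin k with h | ⟨⟨ξa, hξa, hca⟩, ξb, hξb, hcb⟩
    · exact Or.inl h
    · exact Or.inr ⟨⟨ξa, hξa.trans (hγ k hk), hca⟩, ξb, hξb.trans (hγ k hk), hcb⟩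

/-- **The positivity class is NON-EMPTY at #122's window** `2·arctan(7/100)` (`cert.toLP` with #122's
`hsec`): with `lpSplitClass_empty` its optimum lies in `(2·arctan(7/100), 2·arctan(3/40)]`. -/
theorem lpSplitClass_nonempty_at_split8 :
    ∃ Λ : LPSlabCertificate WSCC9.splitLurieLinesSystem,
      ∀ k ξ, |ξ - WSCC9.splitLurieLinesSystem.δs k| ≤ 2 * Real.arctan (7 / 100 : ℝ) → Λ.a k ≤ Real.cos ξ ∧ Real.cos ξ ≤ Λ.b k :=
  ⟨WSCC9LossySplitLines.cert.toLP, Bench.WSCC9LossySplitLines.hsec⟩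

/-- **THE POSITIVITY-CLASS BRACKET on the split presentation**: NON-EMPTY at `2·arctan(37/500)` (≈ 8.464°,
«SPLITU-LPCERT» `WSCC9LossySplitLinesLPCert.lpCert`) and EMPTY at every window `≥ γ₀ = 2·arctan(3/40)`. -/
theorem lpSplitClassCeiling_bracket :
    (∃ Λ : LPSlabCertificate WSCC9.splitLurieLinesSystem,
      ∀ k ξ, |ξ - WSCC9.splitLurieLinesSystem.δs k| ≤ 2 * Real.arctan (37 / 500 : ℝ) → Λ.a k ≤ Real.cos ξ ∧ Real.cos ξ ≤ Λ.b k) ∧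
    ∀ γ' : ℝ, γ₀ ≤ γ' → ¬ ∃ Λ : LPSlabCertificate WSCC9.splitLurieLinesSystem,
      ∀ k ξ, |ξ - WSCC9.splitLurieLinesSystem.δs k| ≤ γ' → Λ.a k ≤ Real.cos ξ ∧ Real.cos ξ ≤ Λ.b k :=
  ⟨WSCC9LossySplitLinesLPCert.lpSplitClass_nonempty, lpSplitClass_empty⟩

/-- «SPLITU-LPCERT»'s window lies strictly below this file's: `2·arctan(37/500) < γ₀ = 2·arctan(3/40)`. -/
theorem γ74_lt_γ₀ : 2 * Real.arctan (37 / 500 : ℝ) < γ₀ := by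
  unfold γ₀
  have h : (37 / 500 : ℝ) < ((u0Q : ℚ) : ℝ) := by norm_num [u0Q]
  have := Real.arctan_strictMono h
  linarith

/-- This window lies ABOVE #127's: `2·arctan(71/1000) < γ₀ = 2·arctan(3/40)` (the class of record is
refuted from 8.122° by `WSCC9LossySplitLinesDual`, the positivity class only from 8.578°). -/
theorem γ₀_dual71_lt_γ₀ : WSCC9LossySplitLinesDual.γ₀ < γ₀ := by
  unfold WSCC9LossySplitLinesDual.γ₀ γ₀
  have h : ((WSCC9LossySplitLinesDual.u0Q : ℚ) : ℝ) < ((u0Q : ℚ) : ℝ) := by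
    norm_num [u0Q, WSCC9LossySplitLinesDual.u0Q]
  have := Real.arctan_strictMono h
  linarith

end Summit.Ventures.GridStability.Lyapunov.WSCC9LossySplitLinesLPDual

end
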